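import Mathlib.LinearAlgebra.Matrix.Permutation
import Literature.NumberTheory.EllipticCurves.TorsionFrobenius
import Literature.NumberTheory.EllipticCurves.GaloisActionProofs
import Literature.NumberTheory.EllipticCurves.HasseWeilGoodReductionFrobeniusProofs
import Literature.NumberTheory.EllipticCurves.LFunctionPrimeCoeff
import Literature.NumberTheory.Automorphic.TunnellLemma
import Literature.NumberTheory.GaloisRepresentations.FrobeniusDensityTheorem
import HarnessLib

/-!
# Frobenius elements on the torsion of an elliptic curve over `ℚ`: proofs

Topic `NumberTheory/EllipticCurves`; `Proofs` companion (theorems only) of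
`Literature.NumberTheory.EllipticCurves.TorsionFrobenius`, which states two named facts used to
decompose `Literature.NumberTheory.EllipticCurves.not_irreducible_of_frobeniusTrace_congr` (`ModPReducibility`; the Galois-theoretic
input of Greenberg–Vatsal 2000, Prop. 3.7, `padicLFunction_mem_integral`):

1. `Literature.NumberTheory.EllipticCurves.chebotarev_geomTorsion` (Chebotarev for the division fields `ℚ(E[n])`: every `σ ∈ Γ_ℚ`
   acts on `E[n]` as an arithmetic Frobenius at a prime of `\bar ℤ` above some `ℓ ∉ S`);
2. `Literature.NumberTheory.EllipticCurves.exists_frobenius_smul_eq_of_dvd_reductionPointCount` (reduction of torsion: at a good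
   `ℓ ≠ p` with `p ∣ #Ẽ(𝔽_ℓ)` every arithmetic Frobenius above `ℓ` fixes a non-zero point of
   `E[p]`).

This file proves:

* `Literature.NumberTheory.EllipticCurves.exists_framedArtinRep_geomTorsion` — the **permutation representation** of `Γ_ℚ` on the
  finite `Γ_ℚ`-set `E[n]`, `Γ_ℚ → Perm(E[n]) ≃ Perm(Fin m) → GL_m(ℂ)` (Mathlib
  `MulAction.toPermHom`, `Equiv.permCongrHom`, `Matrix.permMatrixHom`): an Artin representation
  with open kernel (the kernel contains `⋂_P Stab(P)`, open by `isOpen_stabilizer_point_holds` and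
  `finite_torsionPoints_holds`), faithful on the action (`PEquiv.toMatrix_injective`).
* `Literature.chebotarev_geomTorsion_of_artinRep : Lang.chebotarev_artinRep → chebotarev_geomTorsion` —
  fact 1 relative to the tree's named fact `Literature.NumberTheory.Automorphic.chebotarev_artinRep` (Chebotarev's density
  theorem for Artin representations, Tate *GCFT* §2.4), applied to the permutation representation.
* `Literature.NumberTheory.EllipticCurves.exists_frobenius_pow_smul_eq_geomTorsion` — **unconditionally**, every `σ ∈ Γ_ℚ` acts on
  `E[n]` as a *power* of an arithmetic Frobenius at a prime of `\bar ℤ` above some prime `ℓ ∉ S`: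
  the division form of **Frobenius' density theorem** (1896), which the tree *proves*
  (`FramedGaloisRep.infinite_setOf_frobenius_mem_division`, file
  `GaloisRepresentations/FrobeniusDensityTheorem`: for `ρ` with open kernel and `g ∈ Γ_F` there are
  infinitely many places with a Frobenius `Φ`, `ρ(Φ) = ρ(g)^k`, `(k, ord ρ(g)) = 1`), applied to the
  permutation representation; `ρ(g) = ρ(Φ)^j` by `exists_pow_eq_self_of_coprime`.  This weaker
  statement suffices for `ModPReducibilityProofs` (a fixed vector of `Φ` is a fixed vector of
  every power of `Φ`), which therefore no longer depends on Chebotarev's theorem.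
* `Literature.NumberTheory.EllipticCurves.exists_frobenius_smul_eq_of_dvd_reductionPointCount_holds` — **fact 2, proved** from the
  tree's reduction theory: the reduction map on `p`-primary torsion
  `E(\bar ℚ)[p^∞] → Ẽ_v(\bar k_v)` along an embedding `\bar ℚ → \bar ℚ_v`
  (`WeierstrassCurve.exists_reduceTorsionHom`, file `HasseWeilGoodReductionFrobeniusProofs`:
  Silverman VII.2.1 on prime-to-`ℓ` torsion, injective by VII.3.1(b), intertwining a local Frobenius
  `σ_v` with the `ℓ`-power map), bijective on `p`-torsion by counting (`#E[p] = p² = #Ẽ_v[p]`,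
  III.6.4(b), `exists_eq_of_injective_of_card_torsionBy_le`); a point `Q̃ ∈ Ẽ_v(k_v)` of order
  `p` (Cauchy, `exists_prime_addOrderOf_dvd_card'`; `#Ẽ_v(k_v) = reductionPointCount W ℓ` by
  `natCard_point_reduction_minimal_baseChange`, VII.1.3(b)) is fixed by `Γ_{k_v}`
  (`Affine.Point.map_baseChange`), so its preimage `P ∈ E[p]` is fixed by `σ_v|_{\bar ℚ}`, an
  arithmetic Frobenius at the prime `𝔓₀` cut out by the embedding (`isArithFrobAt_resGalOfEmb`);
  any other pair `(𝔓, φ)` is reached by conjugation (`exists_smul_eq_of_mem_primesAbove_holds`,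
  `IsArithFrobAt.conj`) up to an element of the inertia group `I_𝔓`
  (`IsArithFrobAt.mul_inv_mem_inertia`), which acts trivially on `E[p]` at the good place `v ∤ p`
  (VII.4.1(a), `smul_eq_of_mem_inertia_of_nsmul_eq_zero`, file `GoodReductionUnramifiedProofs`).
  The prime-indexed hypotheses of the fact (`HasGoodReductionAtPrime ℓ`, `(ℓ) ⊆ v`) are moved to
  the place `v` by `hasGoodReductionAtPrime_primesEquiv_iff_holds` (`LFunctionPrimeCoeff`) and
  `primesEquiv_eq_of_natCast_mem`.

## References

* J. H. Silverman, *The Arithmetic of Elliptic Curves*, 2nd ed., GTM 106, Springer 2009: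
  Prop. VII.2.1, Prop. VII.3.1(b) (PDF p. 170), Prop. VII.4.1(a) and its proof (PDF p. 173),
  Cor. III.6.4(b), Prop. VII.1.3(b). [SilvermanAEC2009]
* J. Tate, *Global class field theory*, in Cassels–Fröhlich (1967), Ch. VII §2.4. [TateGCFT1967]
* G. Frobenius, *Über Beziehungen zwischen den Primidealen eines algebraischen Körpers und den
  Substitutionen seiner Gruppe*, S.-B. Preuss. Akad. Wiss. Berlin (1896), 689–703; D. A. Marcus,
  *Number Fields*, 2nd ed. (2018), Ch. 7, Exercise 12 (f). [Marcus2018]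
* J.-P. Serre, *Propriétés galoisiennes des points d'ordre fini des courbes elliptiques*, Invent.
  Math. 15 (1972), §4 (the Galois action on `E[n]` through a finite quotient).

## Design

Theorems only, `namespace Literature`, no instances; axioms of every theorem: `propext`,
`Classical.choice`, `Quot.sound`.  The reduction part works at the level of `E[p]` (not `T_p E`),
following the proof of `WeierstrassCurve.galoisRepTate_frobenius_conj_reductionAt_holds` step by
step with `n = 1`.
-/

noncomputable section

open scoped Classical
open NumberField IsDedekindDomain IsDedekindDomain.HeightOneSpectrum Field WeierstrassCurve

namespace Literature.NumberTheory.EllipticCurves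

/-! ### The permutation Artin representation on `E[n]` -/

/-- A homomorphism from a topological group whose kernel contains an open subgroup is continuous
(it is constant on the cosets of that subgroup). [folklore] -/
theorem continuous_of_isOpen_subgroup_le_ker {G M : Type*} [Group G] [TopologicalSpace G]
    [ContinuousMul G] [Monoid M] [TopologicalSpace M] (f : G →* M) (K : Subgroup G)
    (hK : IsOpen (K : Set G)) (hker : ∀ k ∈ K, f k = 1) : Continuous f := by
  refine continuous_def.mpr fun U _ ↦ isOpen_iff_forall_mem_open.mpr fun g hg ↦ ?_
  refine ⟨(fun k ↦ g * k) '' (K : Set G), ?_, (isOpenMap_mul_left g) _ hK,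
    ⟨1, K.one_mem, mul_one g⟩⟩
  rintro _ ⟨k, hk, rfl⟩
  show f (g * k) ∈ U
  rw [map_mul, hker k hk, mul_one]
  exact hg

/-- The residue characteristic of a finite place `v` of `ℚ`: a prime `ℓ` with `(ℓ : 𝓞 ℚ) ∈ v`
(`ℓ = char (𝓞 ℚ / v)`, a finite field). [folklore] -/
theorem exists_prime_natCast_mem (v : HeightOneSpectrum (𝓞 ℚ)) :
    ∃ ℓ : ℕ, ℓ.Prime ∧ (ℓ : 𝓞 ℚ) ∈ v.asIdeal := by
  haveI : Finite (𝓞 ℚ ⧸ v.asIdeal) := Ideal.finiteQuotientOfFreeOfNeBot v.asIdeal v.ne_bot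
  haveI : IsDomain (𝓞 ℚ ⧸ v.asIdeal) := Ideal.Quotient.isDomain v.asIdeal
  refine ⟨ringChar (𝓞 ℚ ⧸ v.asIdeal), CharP.prime_ringChar _, ?_⟩
  rw [← Ideal.Quotient.eq_zero_iff_mem, map_natCast]
  exact ringChar.Nat.cast_ringChar

/-- The finite places of `ℚ` lying over a prime in a finite set `S` of rational primes form a
finite set (the places above `ℓ ≠ 0` divide the non-zero ideal `(ℓ)`, `Ideal.finite_factors`).
[folklore] -/
theorem finite_setOf_place_over (S : Set ℕ) (hS : S.Finite) :
    (⋃ ℓ ∈ {ℓ ∈ S | ℓ ≠ 0}, {v : HeightOneSpectrum (𝓞 ℚ) | (ℓ : 𝓞 ℚ) ∈ v.asIdeal}).Finite := by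
  refine (hS.subset (Set.sep_subset _ _)).biUnion fun ℓ hℓ ↦ ?_
  have hI : (Ideal.span {(ℓ : 𝓞 ℚ)} : Ideal (𝓞 ℚ)) ≠ ⊥ := by
    rw [Ne, Ideal.span_singleton_eq_bot]
    exact_mod_cast hℓ.2
  refine (Ideal.finite_factors hI).subset fun v hv ↦ ?_
  simp only [Set.mem_setOf_eq] at hv ⊢
  exact (Ideal.dvd_iff_le).mpr ((Ideal.span_singleton_le_iff_mem _).mpr hv)

/-- **The permutation Artin representation of `Γ_ℚ` on `E[n]`** (`n ≠ 0`): there is an Artin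
representation `ρ : Γ_ℚ → GL_m(ℂ)`, `m = #E[n]` — the permutation representation
`Γ_ℚ → Perm(E[n]) ≃ Perm(Fin m) → GL_m(ℂ)` of the finite `Γ_ℚ`-set `E[n]` (Silverman III.6.4;
stabilisers of points of `E(\bar ℚ)` are open) — with open kernel and faithful on the action:
`ρ x = ρ y` forces `x • P = y • P` for all `P ∈ E[n]` (permutation matrices determine the
permutation).  Serre (1972), §4: `Γ_ℚ` acts on `E[n]` through the finite quotient
`Gal(ℚ(E[n])/ℚ)`. [folklore] -/
theorem exists_framedArtinRep_geomTorsion (W : WeierstrassCurve ℚ) [W.IsElliptic] {n : ℤ}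
    (hn : n ≠ 0) :
    ∃ (m : ℕ) (ρ : GaloisRepresentations.FramedArtinRep ℚ m),
      IsOpen (ρ.toMonoidHom.ker : Set (absoluteGaloisGroup ℚ)) ∧
        ∀ x y : absoluteGaloisGroup ℚ, ρ x = ρ y → ∀ P : W.geomTorsion n, x • P = y • P := by
  classical
  -- the finite `Γ_ℚ`-set `X = E[n]`
  set X := W.geomTorsion n with hX
  haveI : Finite X := finite_torsionPoints_holds W (AlgebraicClosure ℚ) hn
  set m : ℕ := Nat.card X
  let e : X ≃ Fin m := Finite.equivFin X
  -- the permutation representation `Γ_ℚ → Perm X ≃ Perm (Fin m) → Matrix → GL`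
  let a : absoluteGaloisGroup ℚ →* Equiv.Perm X := MulAction.toPermHom _ X
  let π : absoluteGaloisGroup ℚ →* Equiv.Perm (Fin m) := e.permCongrHom.toMonoidHom.comp a
  let M : absoluteGaloisGroup ℚ →* Matrix (Fin m) (Fin m) ℂ :=
    (Matrix.permMatrixHom (n := Fin m) (R := ℂ)).comp π
  let ρ₀ : absoluteGaloisGroup ℚ →* GL (Fin m) ℂ := M.toHomUnits
  -- its kernel contains the open subgroup `⋂_{P ∈ X} Stab(P)`
  let K : Subgroup (absoluteGaloisGroup ℚ) := ⨅ P : X, MulAction.stabilizer _ (P : W.geomPoints)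
  have hKopen : IsOpen (K : Set (absoluteGaloisGroup ℚ)) := by
    have : (K : Set (absoluteGaloisGroup ℚ)) =
        ⋂ P : X, (MulAction.stabilizer (absoluteGaloisGroup ℚ) (P : W.geomPoints) : Set _) := by
      simp only [K, Subgroup.coe_iInf]
    rw [this]
    exact isOpen_iInter_of_finite fun P ↦ isOpen_stabilizer_point_holds W (P : W.geomPoints)
  have hKa : ∀ k ∈ K, a k = 1 := by
    intro k hk
    ext P
    have hkP : k ∈ MulAction.stabilizer (absoluteGaloisGroup ℚ) (P : W.geomPoints) :=
      (Subgroup.mem_iInf.mp hk) P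
    rw [MulAction.mem_stabilizer_iff] at hkP
    change ((k • P : X) : W.geomPoints) = (P : W.geomPoints)
    exact hkP
  have hKρ : ∀ k ∈ K, ρ₀ k = 1 := by
    intro k hk
    ext : 1
    change Matrix.permMatrixHom (e.permCongrHom (a k)) = (1 : Matrix (Fin m) (Fin m) ℂ)
    rw [hKa k hk, map_one, map_one]
  have hcont : Continuous ρ₀ := continuous_of_isOpen_subgroup_le_ker ρ₀ K hKopen hKρ
  let ρ : GaloisRepresentations.FramedArtinRep ℚ m := ⟨ρ₀, hcont⟩
  refine ⟨m, ρ, ?_, fun x y hρ P ↦ ?_⟩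
  · -- the kernel contains `K`, hence is open
    exact Subgroup.isOpen_mono (H₁ := K) (fun k hk ↦ MonoidHom.mem_ker.mpr (hKρ k hk)) hKopen
  · -- `ρ x = ρ y` forces `x • P = y • P`
    have hM : M x = M y := by
      have := congr_arg (fun u : GL (Fin m) ℂ ↦ (u : Matrix (Fin m) (Fin m) ℂ)) hρ
      exact this
    have hπ : π x = π y := by
      have h1 : Equiv.Perm.permMatrix ℂ (π x)⁻¹ = Equiv.Perm.permMatrix ℂ (π y)⁻¹ := hM
      have h2 : ((π x)⁻¹).toPEquiv = ((π y)⁻¹).toPEquiv := PEquiv.toMatrix_injective h1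
      have h3 : (π x)⁻¹ = (π y)⁻¹ := by
        refine Equiv.ext fun i ↦ ?_
        have hi := congr_arg (fun q : Fin m ≃. Fin m ↦ q i) h2
        simpa [Equiv.toPEquiv_apply] using hi
      exact inv_injective h3
    have ha : a x = a y := e.permCongrHom.injective hπ
    have := Equiv.congr_fun ha P
    exact this

/-! ### Chebotarev for `ℚ(E[n])` from Chebotarev for Artin representations -/

/-- **Chebotarev for the division fields `ℚ(E[n])`, from Chebotarev for Artin representations**
(relative discharge of the named fact `chebotarev_geomTorsion` of `TorsionFrobenius` from the
named fact `Literature.NumberTheory.Automorphic.chebotarev_artinRep`, Tate *GCFT* §2.4): apply the latter to the permutation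
representation of `Γ_ℚ` on `E[n]` (`exists_framedArtinRep_geomTorsion`), read `ρ φ = ρ σ` as
`φ = σ` on `E[n]`, and discard the finitely many places whose residue characteristic lies in `S`.
[cite: TateGCFT1967, §2.4 (Tchebotarev density theorem)] -/
theorem chebotarev_geomTorsion_of_artinRep (h : Automorphic.chebotarev_artinRep) :
    chebotarev_geomTorsion := by
  intro W _ n hn S hS σ
  obtain ⟨m, ρ, -, hfaith⟩ := exists_framedArtinRep_geomTorsion W hn
  -- Chebotarev for `ρ`, outside the places over `S`
  obtain ⟨v, ⟨-, 𝔓, h𝔓, φ, hφ, hρ⟩, hvB⟩ :=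
    (h ℚ m ρ σ).exists_notMem_finite (finite_setOf_place_over S hS)
  obtain ⟨ℓ, hℓ, hℓv⟩ := exists_prime_natCast_mem v
  have hℓS : ℓ ∉ S := fun hmem ↦ hvB (Set.mem_biUnion (x := ℓ) ⟨hmem, hℓ.ne_zero⟩ hℓv)
  exact ⟨ℓ, v, 𝔓, φ, hℓ, hℓS, hℓv, h𝔓, hφ, fun P ↦ hfaith φ σ hρ P⟩

/-! ### Unconditionally: every `σ` acts on `E[n]` as a power of a Frobenius (Frobenius 1896) -/

/-- **Every `σ ∈ Γ_ℚ` acts on `E[n]` as a power of an arithmetic Frobenius at a prime above some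
`ℓ` outside any finite set** — unconditional, from **Frobenius' density theorem** in division form
(Frobenius 1896; Marcus, *Number Fields*, Ch. 7, Exercise 12 (f)), proved in the tree as
`FramedGaloisRep.infinite_setOf_frobenius_mem_division`: for the permutation Artin representation
`ρ` of `Γ_ℚ` on `E[n]` (open kernel, `exists_framedArtinRep_geomTorsion`) and `g = σ` there are
infinitely many places `v` carrying an arithmetic Frobenius `φ` at a prime `𝔓 ∣ v` of `\bar ℤ` with
`ρ(φ) = ρ(σ)^k`, `k` prime to the order of `ρ(σ)`; then `ρ(σ) = ρ(φ)^j = ρ(φ^j)` for some `j`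
(`exists_pow_eq_self_of_coprime`), i.e. `σ = φ^j` on `E[n]` (faithfulness), and all but finitely
many of these `v` lie over a prime `ℓ ∉ S`.  (Chebotarev's theorem would give `j = 1`,
`chebotarev_geomTorsion`; the power is harmless for fixed vectors.)
[cite: Marcus2018, Ch. 7, Exercise 12 (f) (Frobenius Density Theorem)] -/
theorem exists_frobenius_pow_smul_eq_geomTorsion (W : WeierstrassCurve ℚ) [W.IsElliptic] {n : ℤ}
    (hn : n ≠ 0) (S : Set ℕ) (hS : S.Finite) (σ : absoluteGaloisGroup ℚ) :
    ∃ (ℓ : ℕ) (v : HeightOneSpectrum (𝓞 ℚ)) (𝔓 : Ideal (GaloisRepresentations.absIntegers (𝓞 ℚ) ℚ))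
      (φ : absoluteGaloisGroup ℚ),
      ℓ.Prime ∧ ℓ ∉ S ∧ (ℓ : 𝓞 ℚ) ∈ v.asIdeal ∧ 𝔓 ∈ v.primesAbove ∧ IsArithFrobAt (𝓞 ℚ) φ 𝔓 ∧
        ∃ j : ℕ, ∀ P : W.geomTorsion n, σ • P = (φ ^ j) • P := by
  obtain ⟨m, ρ, hker, hfaith⟩ := exists_framedArtinRep_geomTorsion W hn
  -- Frobenius' theorem for `ρ` and `σ`, outside the places over `S`
  obtain ⟨v, ⟨-, 𝔓, h𝔓, φ, hφ, k, hk, hρ⟩, hvB⟩ :=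
    (GaloisRepresentations.FramedGaloisRep.infinite_setOf_frobenius_mem_division ρ hker σ).exists_notMem_finite
      (finite_setOf_place_over S hS)
  obtain ⟨ℓ, hℓ, hℓv⟩ := exists_prime_natCast_mem v
  have hℓS : ℓ ∉ S := fun hmem ↦ hvB (Set.mem_biUnion (x := ℓ) ⟨hmem, hℓ.ne_zero⟩ hℓv)
  -- `ρ σ = (ρ σ ^ k) ^ j = ρ (φ ^ j)`
  obtain ⟨j, hj⟩ := exists_pow_eq_self_of_coprime hk
  refine ⟨ℓ, v, 𝔓, φ, hℓ, hℓS, hℓv, h𝔓, hφ, j, fun P ↦ hfaith σ (φ ^ j) ?_ P⟩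
  rw [map_pow, hρ, hj]

/-! ### Reduction of torsion: discharge of `exists_frobenius_smul_eq_of_dvd_reductionPointCount` -/

/-- The rational prime `ℓ` contained in a finite place `v` of `ℚ` is its generator
`Rat.HeightOneSpectrum.primesEquiv v` (Mathlib). [folklore] -/
theorem primesEquiv_eq_of_natCast_mem {v : HeightOneSpectrum (𝓞 ℚ)} {ℓ : ℕ} (hℓ : ℓ.Prime)
    (hv : (ℓ : 𝓞 ℚ) ∈ v.asIdeal) : (Rat.HeightOneSpectrum.primesEquiv v : ℕ) = ℓ := by
  have h1 : Rat.HeightOneSpectrum.natGenerator v ∣ ℓ := by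
    rw [Rat.HeightOneSpectrum.natGenerator_dvd_iff, Ideal.mem_map_of_equiv]
    exact ⟨ℓ, hv, map_natCast _ ℓ⟩
  exact (Nat.prime_dvd_prime_iff_eq (Rat.HeightOneSpectrum.prime_natGenerator v) hℓ).mp h1

/-- **An arithmetic Frobenius at a good prime `ℓ ≠ p` with `p ∣ #Ẽ(𝔽_ℓ)` fixes a non-zero
`p`-torsion point — discharge of the named fact
`exists_frobenius_smul_eq_of_dvd_reductionPointCount`** (Silverman, *AEC*, Prop. VII.3.1(b) with
Prop. VII.2.1, the proof of Prop. VII.4.1, and Cor. III.6.4(b)).  Proof.  Let `v` be the place of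
`ℚ` at `ℓ` (`primesEquiv v = ℓ`); `W` has good reduction at `v`
(`hasGoodReductionAtPrime_primesEquiv_iff_holds`) and `v ∤ p`.  The reduction `Ẽ_v / k_v` of the
local minimal model has `#Ẽ_v(k_v) = reductionPointCount W ℓ` points
(`natCard_point_reduction_minimal_baseChange`, VII.1.3(b)), so by Cauchy's theorem there is
`Q̃ ∈ Ẽ_v(k_v)` of order `p`; its image `Q ∈ Ẽ_v(\bar k_v)` is a non-zero `p`-torsion point fixed by
`Γ_{k_v}`.  Choose a prime `𝔐` of `\bar 𝓞_v`, the embedding `ι : \bar ℚ → \bar ℚ_v`, a local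
Frobenius `σ_v ∈ Γ_{ℚ_v}` at `𝔐` and the `ℓ`-power Frobenius `φ_k ∈ Γ_{k_v}`; the reduction map
`f : E(\bar ℚ)[p^∞] → Ẽ_v(\bar k_v)` (`exists_reduceTorsionHom`: VII.2.1, injective by VII.3.1(b),
`f (σ₀ P) = φ_k (f P)` for `σ₀ = σ_v|_{\bar ℚ}`) hits `Q` with some `P ∈ E[p]` (counting,
`#E[p] = p² = #Ẽ_v[p]`, III.6.4(b)), `P ≠ O`, and `f (σ₀ P) = φ_k Q = Q = f P` gives `σ₀ P = P`.
Now `σ₀` is an arithmetic Frobenius at the prime `𝔓₀ = 𝔓_{ι,𝔐}` (`isArithFrobAt_resGalOfEmb`);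
for the given `(𝔓, φ)` pick `τ ∈ Γ_ℚ` with `τ 𝔓₀ = 𝔓` (transitivity); then `γ = τ σ₀ τ⁻¹` is a
Frobenius at `𝔓` fixing `P₁ = τ P ∈ E[p] ∖ {O}`, and `φ γ⁻¹ ∈ I_𝔓` fixes `P₁` as well since
`E[p]` is unramified at the good place `v ∤ p` (VII.4.1(a),
`smul_eq_of_mem_inertia_of_nsmul_eq_zero`); hence `φ P₁ = P₁`.
[cite: SilvermanAEC2009, Prop. VII.3.1(b) (PDF p. 170), Prop. VII.2.1, proof of Prop. VII.4.1 (PDF p. 173), Cor. III.6.4(b)] -/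
theorem exists_frobenius_smul_eq_of_dvd_reductionPointCount_holds :
    exists_frobenius_smul_eq_of_dvd_reductionPointCount := by
  intro W _ _ p ℓ _ _ hℓp hgoodℓ hdvd v hv 𝔓 h𝔓 φ hφ
  classical
  have hp : p.Prime := Fact.out
  have hℓ : ℓ.Prime := Fact.out
  -- Step 0: from the rational prime `ℓ` to the place `v`
  have hvℓ : (Rat.HeightOneSpectrum.primesEquiv v : ℕ) = ℓ := primesEquiv_eq_of_natCast_mem hℓ hv
  have hgood : W.HasGoodReductionAt v :=
    (hasGoodReductionAtPrime_primesEquiv_iff_holds W v ℓ hvℓ).mp hgoodℓ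
  have hpv : (p : 𝓞 ℚ) ∉ v.asIdeal := fun h ↦
    hℓp (hvℓ.symm.trans (primesEquiv_eq_of_natCast_mem hp h))
  -- the reduction `Ẽ_v / k_v`, an elliptic curve over the finite field `k_v`
  set k := IsLocalRing.ResidueField (v.adicCompletionIntegers ℚ) with hk
  set Wt : WeierstrassCurve k := W.reductionAt v with hWt
  haveI : Wt.IsElliptic := isElliptic_reductionAt hgood
  -- Step 1: a `k_v`-rational point of order `p` (Cauchy), as a point over `\bar k_v`
  have hWtk : Wt.baseChange k = Wt := by
    rw [baseChange, Algebra.algebraMap_self, map_id]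
  have hcard : Nat.card (Wt.baseChange k).toAffine.Point = W.reductionPointCount ℓ := by
    rw [hWtk, ← hvℓ]
    exact natCard_point_reduction_minimal_baseChange v W
  haveI hfin : Finite (Wt.baseChange k).toAffine.Point :=
    Nat.finite_of_card_ne_zero (by rw [hcard]; exact (W.reductionPointCount_pos ℓ).ne')
  obtain ⟨Q₀, hQ₀⟩ :=
    exists_prime_addOrderOf_dvd_card' (G := (Wt.baseChange k).toAffine.Point) p
      (by rw [hcard]; exact hdvd)
  set Q : geomPoints Wt := Affine.Point.baseChange k (AlgebraicClosure k) Q₀ with hQdef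
  have hQ0 : Q ≠ 0 := by
    intro h
    have h0 : Q₀ = 0 := Affine.Point.map_injective _ (h.trans (map_zero _).symm)
    rw [h0, addOrderOf_zero] at hQ₀
    exact hp.one_lt.ne hQ₀
  have hpQ : p • Q = 0 := by
    have h1 : Affine.Point.baseChange k (AlgebraicClosure k) (p • Q₀) = 0 := by
      rw [← hQ₀, addOrderOf_nsmul_eq_zero, map_zero]
    rw [map_nsmul] at h1
    exact h1
  have hQfix : ∀ g : absoluteGaloisGroup k, g • Q = Q := fun g ↦ by
    change Affine.Point.map
      ((show AlgebraicClosure k ≃ₐ[k] AlgebraicClosure k from g) :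
        AlgebraicClosure k →ₐ[k] AlgebraicClosure k) (Affine.Point.baseChange k _ Q₀) = _
    exact Affine.Point.map_baseChange _ Q₀
  -- Step 2: the reduction map on `p`-primary torsion along `ι`, for a local Frobenius `σ_v`
  obtain ⟨𝔐, h𝔐⟩ := v.localPrimesAbove_nonempty
  let ι : AlgebraicClosure ℚ →ₐ[ℚ] AlgebraicClosure (v.adicCompletion ℚ) :=
    closureEmb (K := ℚ) (v.adicCompletion ℚ)
  obtain ⟨σL, hσL⟩ := v.exists_isArithFrobAt_localAbsIntegers h𝔐
  obtain ⟨φk, hφk⟩ := exists_frobenius_absoluteGaloisGroup k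
  obtain ⟨f, hf, hfσ⟩ := exists_reduceTorsionHom hpv hgood h𝔐 ι hσL hφk
  set σ₀ : absoluteGaloisGroup ℚ := resGalOfEmb ι σL with hσ₀
  -- `f` hits the `p`-torsion: `#E[p] = p² = #Ẽ_v[p]`
  have hA : Nat.card (geomTorsion W (p ^ 1 : ℕ)) = (p ^ 1) ^ 2 :=
    card_torsionPoints_eq_sq_holds W (AlgebraicClosure ℚ)
      (Nat.cast_ne_zero.mpr (pow_ne_zero 1 hp.ne_zero))
  have hpk : ((p ^ 1 : ℕ) : AlgebraicClosure k) ≠ 0 := by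
    rw [← map_natCast (algebraMap k _), _root_.map_ne_zero, Nat.cast_pow]
    exact pow_ne_zero 1 (natCast_residueField_ne_zero hpv)
  have hB : Nat.card (geomTorsion Wt (p ^ 1 : ℕ)) = (p ^ 1) ^ 2 :=
    card_torsionPoints_eq_sq_holds Wt _ hpk
  haveI : Finite (geomTorsion Wt (p ^ 1 : ℕ)) :=
    Nat.finite_of_card_ne_zero (by rw [hB]; exact pow_ne_zero _ (pow_ne_zero _ hp.ne_zero))
  obtain ⟨P, hpP, hPQ⟩ :=
    exists_eq_of_injective_of_card_torsionBy_le f hf (hB.trans hA.symm).le (b := Q)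
      (by rw [pow_one]; exact hpQ)
  -- `σ₀` fixes `P`
  have hσ₀P : σ₀ • P = P := hf (by rw [hfσ, hPQ, hQfix])
  -- Step 3: transport from `(𝔓₀, σ₀)` to `(𝔓, φ)`
  have h𝔓₀ : v.primeBelow ι 𝔐 ∈ v.primesAbove := primeBelow_mem_primesAbove h𝔐
  have hσ₀F : IsArithFrobAt (𝓞 ℚ) σ₀ (v.primeBelow ι 𝔐) := isArithFrobAt_resGalOfEmb h𝔐 ι hσL
  obtain ⟨τ, hτ⟩ := exists_smul_eq_of_mem_primesAbove_holds h𝔓₀ h𝔓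
  have hγ : IsArithFrobAt (𝓞 ℚ) (τ * σ₀ * τ⁻¹) 𝔓 := hτ ▸ hσ₀F.conj τ
  have hI : φ * (τ * σ₀ * τ⁻¹)⁻¹ ∈ 𝔓.inertia (absoluteGaloisGroup ℚ) := hφ.mul_inv_mem_inertia hγ
  -- the point `P₁ = τ • P ∈ E[p] ∖ {O}`
  have hpP' : p • (P : geomPoints W) = 0 := by
    have := congrArg Subtype.val hpP
    simpa only [pow_one, AddSubgroupClass.coe_nsmul, ZeroMemClass.coe_zero] using this
  have hP0 : (P : geomPoints W) ≠ 0 := by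
    intro h
    apply hQ0
    rw [← hPQ, show P = 0 from Subtype.ext h, map_zero]
  have hσ₀P' : σ₀ • (P : geomPoints W) = P := by
    have := congrArg Subtype.val hσ₀P
    rwa [primaryComponent.coe_smul] at this
  obtain ⟨P₁, hP₁⟩ : ∃ P₁ : geomPoints W, P₁ = τ • (P : geomPoints W) := ⟨_, rfl⟩
  have hpP₁ : p • P₁ = 0 := by
    rw [hP₁, ← smul_comm τ p (P : geomPoints W), hpP', smul_zero]
  have hP₁0 : P₁ ≠ 0 := fun h ↦ hP0 ((smul_eq_zero_iff_eq τ).mp (hP₁ ▸ h))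
  have hγP₁ : (τ * σ₀ * τ⁻¹) • P₁ = P₁ := by
    rw [hP₁, mul_smul, mul_smul, inv_smul_smul, hσ₀P']
  have hφP₁ : φ • P₁ = P₁ := by
    have h1 : φ • P₁ = (φ * (τ * σ₀ * τ⁻¹)⁻¹) • ((τ * σ₀ * τ⁻¹) • P₁) := by
      rw [← mul_smul, inv_mul_cancel_right]
    rw [h1, hγP₁]
    exact W.smul_eq_of_mem_inertia_of_nsmul_eq_zero hgood hpv h𝔓 hI hpP₁
  refine ⟨⟨P₁, AddSubgroup.torsionBy.nsmul_iff.mpr hpP₁⟩, fun h ↦ hP₁0 (congrArg Subtype.val h),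
    Subtype.ext ?_⟩
  rw [AddSubgroup.torsionBy.coe_smul]
  exact hφP₁

end Literature.NumberTheory.EllipticCurves
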